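import Literature.Computability.AlgebraicComplexity.BurgisserTransferProofs
import Literature.Computability.AlgebraicComplexity.RealTauConjectureAssembly
import HarnessLib

/-!
# Bürgisser's transfer theorem from four named facts

Assembly file for the named fact
`Literature.Computability.AlgebraicComplexity.not_isPBounded_constantFreeComplexity_perPoly_of_tauConjecture` (`TauConjecture.lean`;
Bürgisser 2009, Main Thm. 1.2 = ECCC TR06-113 Thm. 1.1(2): the Shub–Smale τ-conjecture implies
that `τ(PER_n)` is not polynomially bounded). `BurgisserTransferProofs.lean` reduces it to five
cited facts (`…_of_facts`); Lemma 2.5(2) is now DISCHARGED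
(`CH_subset_PPoly_of_PP_subset_PPoly_holds`, `RealTauConjectureAssembly.lean`, from circuit
evaluation in `P`, `CircuitEval.lean`), which leaves four:
Cor. 3.9 (`Burgisser2009_esymm_chDefinable`), Lemma 2.12 (`PP_subset_PPoly_of_isPBounded_perPoly`),
Thm. 2.10 (`Burgisser2009_thm210`, constant-free Valiant completeness of the permanent) and the
application of Thm. 2.11 (`Burgisser2009_thm41_koiranStep`, Koiran's `#P/poly ⇒ VNP⁰`).

## References

* P. Bürgisser, *On defining integers and proving arithmetic circuit lower bounds*, Comput.
  Complexity 18 (2009) 81–103 (= ECCC TR06-113), Thm. 1.1(2), Lemma 2.5, Lemma 2.12, Thm. 2.10,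
  Thm. 2.11, Cor. 3.9, Thm. 4.1(2).
* S. Arora, B. Barak, *Computational Complexity* (2009), Thm. 6.18.
-/

namespace Literature.Computability.AlgebraicComplexity

open Complexity

/-- **Bürgisser's Thm. 4.1(2) (uniform form) from three named facts** (Lemma 2.12, Thm. 2.10 and
the Thm. 2.11-application), Lemma 2.5(2) being discharged. [cite: Burgisser2006, Thm. 4.1(2)] -/
theorem Burgisser2009_thm41_2_uniform_of_facts (h212 : PP_subset_PPoly_of_isPBounded_perPoly)
    (h210 : Burgisser2009_thm210) (hK : Burgisser2009_thm41_koiranStep) : Burgisser2009_thm41_2_uniform :=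
  Burgisser2009_thm41_2_uniform_of_steps h212 CH_subset_PPoly_of_PP_subset_PPoly_holds h210 hK

/-- **Bürgisser's Theorem 1.1(2) from four named facts** — Cor. 3.9
(`Burgisser2009_esymm_chDefinable`), Lemma 2.12 (`PP_subset_PPoly_of_isPBounded_perPoly`),
Thm. 2.10 (`Burgisser2009_thm210`) and the application of Thm. 2.11
(`Burgisser2009_thm41_koiranStep`): the coefficient definability (from Cor. 3.9), Lemma 2.5(2)
(circuit evaluation and the level-by-level collapse), the Thm. 4.1(2) assembly and the final root
count are proved in the tree. [cite: Burgisser2006, Thm. 1.1(2)] -/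
theorem not_isPBounded_constantFreeComplexity_perPoly_of_tauConjecture_of_facts'
    (h39 : Burgisser2009_esymm_chDefinable) (h212 : PP_subset_PPoly_of_isPBounded_perPoly)
    (h210 : Burgisser2009_thm210) (hK : Burgisser2009_thm41_koiranStep) :
    not_isPBounded_constantFreeComplexity_perPoly_of_tauConjecture :=
  not_isPBounded_constantFreeComplexity_perPoly_of_tauConjecture_of_facts h39 h212
    CH_subset_PPoly_of_PP_subset_PPoly_holds h210 hK

end Literature.Computability.AlgebraicComplexity
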